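import Mathlib
import HarnessLib
import Literature.Probability.MarkovChains.MetropolisHastings
import Literature.Probability.MarkovChains.TotalVariation
import Summits.Ventures.LatticeQCDFlow.Exactness.JarzynskiFinite
import Summits.Ventures.LatticeQCDFlow.Scaling.ImportanceWeights
import Summits.Ventures.LatticeQCDFlow.Scaling.StochasticFlows
import Summits.Ventures.LatticeQCDFlow.Scaling.StochasticBudgets

/-!
# LatticeQCDFlow / Scaling — perfect relaxation dominates MONOTONE layers ((C3″), proved)

HONEST FRAMING: exact (Metropolis-corrected) sampling algorithms for lattice gauge theory;
figures of merit are autocorrelation/cost numbers at stated couplings and volumes; no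
continuum-physics claim.

Venture `LatticeQCDFlow` (cell pub-lqcd), topic `Scaling`, THEORY-2.md §3.5 (theory seat GEN-10).
The conjecture item (C3′) `Conjectures.PerfectRelaxationDominates` (perfect relaxation maximises
the NE-MCMC / SNF reweighting ESS among REVERSIBLE POSITIVE-SEMIDEFINITE layers) is FALSE: row 30's
`not_perfectRelaxationDominates` (3 states, 2 layers, a rank-one PSD perturbation of perfect
relaxation anti-correlating `e^{−(β₁−β₀)A}` with `e^{−2(β₂−β₁)A}`).  The mechanism of that witness
names the right hypothesis: what perfect relaxation really dominates is the class of layers that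
PRESERVE THE CONE OF FUNCTIONS ANTITONE IN THE ORDER PARAMETER `A` (stochastically monotone
kernels for the preorder `A x ≤ A y`: independent resampling, the identity, lazy mixtures of them,
…).  This file proves it — (C3″), with NO positive-semidefiniteness and with detailed balance
weakened to stationarity:

* `chebyshev_sum_comonotone` — the weighted Chebyshev sum inequality
  `(Σ m f)(Σ m g) ≤ (Σ m)(Σ m f g)` for `m ≥ 0` and comonotone `f, g`;
* `sqBack` — the backward second-moment function of the work, `B_n ≡ 1`,
  `B_k = e^{−2(S_{k+1}−S_k)} · P_k B_{k+1}`, with `Σ_ω P_F(ω) e^{−2W(ω)} = Σ_x μ₀(x) B₀(x)`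
  (`sum_pathLaw_mul_exp_sq`); it is non-negative and, for monotone increments and monotone layers,
  ANTITONE in `A` (`sqBack_antitone`);
* `sqMoment_perfect_le` — THE CORE: `Σ p₀ B₀^{perfect} ≤ Σ p₀ B₀^{P}`, by induction on the number
  of layers: peel the first layer, `p₀ e^{−2ΔS₀} = Z₀⁻¹ e^{−S₁} e^{−ΔS₀}`, Chebyshev for the
  comonotone pair `(e^{−ΔS₀}, P₀ B₁)` under the weight `e^{−S₁}`, stationarity `Σ_x e^{−S₁(x)}
  P₀(x, ·) = e^{−S₁}`, induction hypothesis;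
* `perfectRelaxation_dominates_monotone` — (C3″): for a protocol with increments `S_{k+1} − S_k`
  non-decreasing in `A`, positive layers leaving `e^{−S_{k+1}}` stationary and preserving
  `A`-antitone functions, `ÊSS = essFrac (revPathLaw S P) (pathLaw p₀ P) ≤ Π_k ESS(p_{k+1}, p_k)`
  (Crooks/Jarzynski: equal numerators `(Z_n/Z_0)²`; the denominators are the second moments);
* `perfectRelaxation_dominates_expFamily` — the exponential-family form `S_k = β_k · A`,
  `β` monotone, in the binder format of (C3′) with positive-semidefiniteness REPLACED by
  monotonicity of the layers.

The 2-state remark of row 30 (every reversible PSD layer on 2 states is `Π + ε(I − Π)`, hence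
monotone) is the overlap of the two classes.  References: arXiv:2510.25704 §2.1, §3.1 (NE-MCMC for
lattice gauge theory; the perfect-relaxation law); Bonanno–Nada–Vadacchino (SNF).  [folklore]
-/

noncomputable section

namespace Summit.Ventures.LatticeQCDFlow.Theory2

open Finset Literature.Probability.MarkovChains Summit.Ventures.LatticeQCDFlow.Exactness

variable {X : Type*} [Fintype X]

/-! ## Chebyshev's sum inequality -/

/-- **Weighted Chebyshev sum inequality**: for a non-negative weight `m` and comonotone `f, g`
(`(f x − f y)(g x − g y) ≥ 0`), `(Σ m f)(Σ m g) ≤ (Σ m)(Σ m f g)`. [folklore] -/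
theorem chebyshev_sum_comonotone (m f g : X → ℝ) (hm : ∀ x, 0 ≤ m x)
    (hfg : ∀ x y, 0 ≤ (f x - f y) * (g x - g y)) :
    (∑ x, m x * f x) * (∑ x, m x * g x) ≤ (∑ x, m x) * ∑ x, m x * (f x * g x) := by
  have h : 0 ≤ ∑ x, ∑ y, m x * m y * ((f x - f y) * (g x - g y)) :=
    sum_nonneg fun x _ => sum_nonneg fun y _ => mul_nonneg (mul_nonneg (hm x) (hm y)) (hfg x y)
  have hx : ∀ x y, m x * m y * ((f x - f y) * (g x - g y)) =
      m x * (f x * g x) * m y + m x * (m y * (f y * g y)) - m x * f x * (m y * g y) -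
        m x * g x * (m y * f y) := fun x y => by ring
  simp only [hx, sum_sub_distrib, sum_add_distrib, ← mul_sum, ← sum_mul] at h
  nlinarith [h]

omit [Fintype X] in
/-- Two functions antitone in the same order parameter are comonotone. [folklore] -/
theorem comonotone_of_antitone (A f g : X → ℝ) (hf : ∀ x y, A x ≤ A y → f y ≤ f x)
    (hg : ∀ x y, A x ≤ A y → g y ≤ g x) (x y : X) : 0 ≤ (f x - f y) * (g x - g y) := by
  rcases le_total (A x) (A y) with h | h
  · exact mul_nonneg (sub_nonneg.mpr (hf x y h)) (sub_nonneg.mpr (hg x y h))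
  · exact mul_nonneg_of_nonpos_of_nonpos (sub_nonpos.mpr (hf y x h)) (sub_nonpos.mpr (hg y x h))

/-! ## The hypothesis class is inhabited: perfect relaxation, the identity, lazy mixtures -/

omit [Fintype X] in
/-- An `A`-antitone function stays `A`-antitone under the IDENTITY layer (trivial) — recorded
with the next two lemmas to show the monotone class of (C3″) contains the lazy heat-bath layers
`ε·I + (1−ε)·Π` used in the numerical evidence for (C3′). [folklore] -/
theorem antitone_id_layer (A f : X → ℝ) (hf : ∀ x y, A x ≤ A y → f y ≤ f x) (x y : X)
    (hxy : A x ≤ A y) : f y ≤ f x := hf x y hxy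

/-- PERFECT RELAXATION (`P x z = p z`, independent of `x`) is `A`-monotone: its output is
constant. [folklore] -/
theorem monotone_layer_perfect (p f : X → ℝ) (x y : X) :
    ∑ z, (fun (_ : X) (z : X) => p z) y z * f z ≤ ∑ z, (fun (_ : X) (z : X) => p z) x z * f z :=
  le_rfl

/-- LAZY PERFECT RELAXATION `ε·I + (1−ε)·Π` (`0 ≤ ε`) is `A`-monotone. [folklore] -/
theorem monotone_layer_lazy [DecidableEq X] (A p : X → ℝ) {ε : ℝ} (hε : 0 ≤ ε) (f : X → ℝ)
    (hf : ∀ x y, A x ≤ A y → f y ≤ f x) (x y : X) (hxy : A x ≤ A y) :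
    ∑ z, (ε * (if z = y then 1 else 0) + (1 - ε) * p z) * f z ≤
      ∑ z, (ε * (if z = x then 1 else 0) + (1 - ε) * p z) * f z := by
  have hsplit : ∀ w : X, ∑ z, (ε * (if z = w then 1 else 0) + (1 - ε) * p z) * f z =
      ε * f w + (1 - ε) * ∑ z, p z * f z := by
    intro w
    simp only [add_mul, sum_add_distrib, mul_ite, mul_one, mul_zero, ite_mul, zero_mul,
      Finset.sum_ite_eq', Finset.mem_univ, if_true, mul_assoc, ← mul_sum]
  rw [hsplit, hsplit]
  have := hf x y hxy
  nlinarith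

/-! ## The backward second-moment function -/

/-- **Backward second-moment function of the work**: `B_n ≡ 1`,
`B_k(x) = e^{−2(S_{k+1}(x) − S_k(x))} · Σ_z P_k(x, z) B_{k+1}(z)` (here indexed from the front:
`sqBack (n+1) S P = e^{−2(S 1 − S 0)} · P 0 (sqBack n (S ∘ succ) (P ∘ succ))`). [folklore] -/
def sqBack : (n : ℕ) → (Fin (n + 1) → X → ℝ) → (Fin n → X → X → ℝ) → X → ℝ
  | 0, _, _, _ => 1
  | n + 1, S, P, x => Real.exp (-(S 1 x - S 0 x)) ^ 2 *
      ∑ z, P 0 x z * sqBack n (fun k => S k.succ) (fun k => P k.succ) z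

/-- `Σ_ω P_F(ω) e^{−2W(ω)} = Σ_x μ₀(x) B₀(x)` for every initial weight `μ₀`. [folklore] -/
theorem sum_pathLaw_mul_exp_sq : ∀ (n : ℕ) (μ : X → ℝ) (S : Fin (n + 1) → X → ℝ)
    (P : Fin n → X → X → ℝ),
    ∑ ω : Fin (n + 1) → X, pathLaw μ P ω * Real.exp (-(work S ω)) ^ 2 =
      ∑ x, μ x * sqBack n S P x
  | 0, μ, S, P => by
      rw [sum_path_zero]
      refine sum_congr rfl fun x _ => ?_
      simp [pathLaw, transProb, work, sqBack]
  | n + 1, μ, S, P => by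
      rw [sum_path_cons]
      refine sum_congr rfl fun x₀ _ => ?_
      have ih := sum_pathLaw_mul_exp_sq n (P 0 x₀) (fun k => S k.succ) (fun k => P k.succ)
      have hterm : ∀ ω : Fin (n + 1) → X,
          pathLaw μ P (Fin.cons x₀ ω : Fin (n + 2) → X) *
              Real.exp (-(work S (Fin.cons x₀ ω : Fin (n + 2) → X))) ^ 2 =
            μ x₀ * Real.exp (-(S 1 x₀ - S 0 x₀)) ^ 2 *
              (pathLaw (P 0 x₀) (fun k => P k.succ) ω *
                Real.exp (-(work (fun k => S k.succ) ω)) ^ 2) := by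
        intro ω
        simp only [pathLaw, transProb_cons, work_cons, Fin.cons_zero]
        rw [neg_add, Real.exp_add, mul_pow]
        ring
      simp only [hterm]
      rw [← mul_sum, ih, sqBack]
      ring

/-- `B ≥ 0` for non-negative layers. [folklore] -/
theorem sqBack_nonneg : ∀ (n : ℕ) (S : Fin (n + 1) → X → ℝ) (P : Fin n → X → X → ℝ),
    (∀ k x y, 0 ≤ P k x y) → ∀ x, 0 ≤ sqBack n S P x
  | 0, S, P, _, x => by simp [sqBack]
  | n + 1, S, P, hP, x => by
      rw [sqBack]
      exact mul_nonneg (pow_nonneg (Real.exp_pos _).le _) (sum_nonneg fun z _ =>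
        mul_nonneg (hP 0 x z) (sqBack_nonneg n _ _ (fun k => hP k.succ) z))

/-- **`B` is antitone in the order parameter** when the increments `S_{k+1} − S_k` are
non-decreasing in `A` and the layers are non-negative and preserve `A`-antitone functions.
[folklore] -/
theorem sqBack_antitone (A : X → ℝ) : ∀ (n : ℕ) (S : Fin (n + 1) → X → ℝ)
    (P : Fin n → X → X → ℝ),
    (∀ (k : Fin n) (x y : X), A x ≤ A y →
      S k.succ x - S k.castSucc x ≤ S k.succ y - S k.castSucc y) →
    (∀ k x y, 0 ≤ P k x y) →
    (∀ (k : Fin n) (f : X → ℝ), (∀ x y, A x ≤ A y → f y ≤ f x) →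
      ∀ x y, A x ≤ A y → ∑ z, P k y z * f z ≤ ∑ z, P k x z * f z) →
    ∀ x y, A x ≤ A y → sqBack n S P y ≤ sqBack n S P x
  | 0, S, P, _, _, _, x, y, _ => by simp [sqBack]
  | n + 1, S, P, hinc, hP, hmono, x, y, hxy => by
      rw [sqBack, sqBack]
      have ih := sqBack_antitone A n (fun k => S k.succ) (fun k => P k.succ)
        (fun k => hinc k.succ) (fun k => hP k.succ) (fun k => hmono k.succ)
      have h1 : Real.exp (-(S 1 y - S 0 y)) ^ 2 ≤ Real.exp (-(S 1 x - S 0 x)) ^ 2 := by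
        refine pow_le_pow_left₀ (Real.exp_pos _).le (Real.exp_le_exp.mpr ?_) 2
        have := hinc 0 x y hxy
        simp only [Fin.succ_zero_eq_one, Fin.castSucc_zero] at this
        linarith
      have h2 := hmono 0 _ ih x y hxy
      exact mul_le_mul h1 h2 (sum_nonneg fun z _ => mul_nonneg (hP 0 y z)
        (sqBack_nonneg n _ _ (fun k => hP k.succ) z)) (pow_nonneg (Real.exp_pos _).le _)

/-! ## The core comparison -/

/-- The first-layer split: `p₀(x) B₀(x) = Z₀⁻¹ · e^{−S₁(x)} · e^{−(S₁−S₀)(x)} · (P₀ B₁)(x)`.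
[folklore] -/
theorem gibbsLaw_mul_sqBack_succ (n : ℕ) (S : Fin (n + 2) → X → ℝ)
    (P : Fin (n + 1) → X → X → ℝ) (x : X) :
    gibbsLaw (S 0) x * sqBack (n + 1) S P x =
      (partitionFn (S 0))⁻¹ * (Real.exp (-(S 1 x)) * (Real.exp (-(S 1 x - S 0 x)) *
        ∑ z, P 0 x z * sqBack n (fun k => S k.succ) (fun k => P k.succ) z)) := by
  rw [sqBack, gibbsLaw]
  have h : Real.exp (-(S 0 x)) * Real.exp (-(S 1 x - S 0 x)) ^ 2 =
      Real.exp (-(S 1 x)) * Real.exp (-(S 1 x - S 0 x)) := by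
    rw [sq, ← mul_assoc, ← Real.exp_add, ← Real.exp_add, ← Real.exp_add]
    congr 1
    ring
  calc Real.exp (-S 0 x) / partitionFn (S 0) * (Real.exp (-(S 1 x - S 0 x)) ^ 2 *
        ∑ z, P 0 x z * sqBack n (fun k => S k.succ) (fun k => P k.succ) z)
      = (partitionFn (S 0))⁻¹ * ((Real.exp (-(S 0 x)) * Real.exp (-(S 1 x - S 0 x)) ^ 2) *
          ∑ z, P 0 x z * sqBack n (fun k => S k.succ) (fun k => P k.succ) z) := by ring
    _ = _ := by rw [h]; ring

/-- Independent resampling from `e^{−S_{k+1}}/Z_{k+1}` leaves `e^{−S_{k+1}}` stationary.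
[folklore] -/
theorem isStationary_perfect [Nonempty X] {n : ℕ} (S : Fin (n + 1) → X → ℝ) (k : Fin n) :
    IsStationary (fun x => Real.exp (-(S k.succ x))) (fun _ y => gibbsLaw (S k.succ) y) := by
  intro y
  rw [← sum_mul, gibbsLaw, mul_comm]
  exact div_mul_cancel₀ _ (partitionFn_pos (S k.succ)).ne'

/-- **THE CORE of (C3″)**: the second moment of `e^{−W}` under PERFECT relaxation is at most the
second moment under any protocol of non-negative, `e^{−S_{k+1}}`-stationary, `A`-monotone layers,
when the increments `S_{k+1} − S_k` are non-decreasing in `A`. [folklore] -/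
theorem sqMoment_perfect_le [Nonempty X] (A : X → ℝ) : ∀ (n : ℕ) (S : Fin (n + 1) → X → ℝ)
    (P : Fin n → X → X → ℝ),
    (∀ (k : Fin n) (x y : X), A x ≤ A y →
      S k.succ x - S k.castSucc x ≤ S k.succ y - S k.castSucc y) →
    (∀ k x y, 0 ≤ P k x y) →
    (∀ k : Fin n, IsStationary (fun x => Real.exp (-(S k.succ x))) (P k)) →
    (∀ (k : Fin n) (f : X → ℝ), (∀ x y, A x ≤ A y → f y ≤ f x) →
      ∀ x y, A x ≤ A y → ∑ z, P k y z * f z ≤ ∑ z, P k x z * f z) →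
    ∑ x, gibbsLaw (S 0) x * sqBack n S (fun k _ y => gibbsLaw (S k.succ) y) x ≤
      ∑ x, gibbsLaw (S 0) x * sqBack n S P x
  | 0, S, P, _, _, _, _ => by simp [sqBack]
  | n + 1, S, P, hinc, hP, hst, hmono => by
      -- data of the first layer
      set S' : Fin (n + 1) → X → ℝ := fun k => S k.succ with hS'
      set B : X → ℝ := sqBack n S' (fun k => P k.succ) with hB
      set Bp : X → ℝ := sqBack n S' (fun k _ y => gibbsLaw (S' k.succ) y) with hBp
      set m : X → ℝ := fun x => Real.exp (-(S 1 x)) with hm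
      set u : X → ℝ := fun x => Real.exp (-(S 1 x - S 0 x)) with hu
      set g : X → ℝ := fun x => ∑ z, P 0 x z * B z with hg
      have hm0 : ∀ x, 0 ≤ m x := fun x => (Real.exp_pos _).le
      have hZ1 : 0 < partitionFn (S 1) := partitionFn_pos (S 1)
      have hZ0 : 0 < partitionFn (S 0) := partitionFn_pos (S 0)
      have hZ1eq : ∑ x, m x = partitionFn (S 1) := rfl
      -- induction hypothesis one level up
      have ih : ∑ z, gibbsLaw (S 1) z * Bp z ≤ ∑ z, gibbsLaw (S 1) z * B z :=
        sqMoment_perfect_le A n S' (fun k => P k.succ) (fun k => hinc k.succ) (fun k => hP k.succ)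
          (fun k => hst k.succ) (fun k => hmono k.succ)
      -- antitonicity of `u` and of `g = P₀ B`
      have hu_anti : ∀ x y, A x ≤ A y → u y ≤ u x := fun x y hxy => by
        have := hinc 0 x y hxy
        simp only [Fin.succ_zero_eq_one, Fin.castSucc_zero] at this
        exact Real.exp_le_exp.mpr (by linarith)
      have hB_anti : ∀ x y, A x ≤ A y → B y ≤ B x :=
        sqBack_antitone A n S' (fun k => P k.succ) (fun k => hinc k.succ) (fun k => hP k.succ)
          (fun k => hmono k.succ)
      have hg_anti : ∀ x y, A x ≤ A y → g y ≤ g x := hmono 0 B hB_anti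
      -- Chebyshev under the weight `m = e^{−S₁}`
      have hcheb :=
        chebyshev_sum_comonotone m u g hm0 (comonotone_of_antitone A u g hu_anti hg_anti)
      -- stationarity: `Σ m g = Σ m B = Z₁ · Σ p₁ B`
      have hst0 : ∀ z, ∑ x, m x * P 0 x z = m z := by
        have := hst 0
        simp only [Literature.Probability.MarkovChains.IsStationary, Fin.succ_zero_eq_one] at this
        exact this
      have hmg : ∑ x, m x * g x = partitionFn (S 1) * ∑ z, gibbsLaw (S 1) z * B z := by
        calc ∑ x, m x * g x = ∑ z, (∑ x, m x * P 0 x z) * B z := by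
              simp only [hg, mul_sum, sum_mul]
              rw [sum_comm]
              refine sum_congr rfl fun z _ => sum_congr rfl fun x _ => ?_
              ring
          _ = ∑ z, m z * B z := sum_congr rfl fun z _ => by rw [hst0 z]
          _ = partitionFn (S 1) * ∑ z, gibbsLaw (S 1) z * B z := by
              rw [mul_sum]
              refine sum_congr rfl fun z _ => ?_
              rw [gibbsLaw, ← mul_assoc, mul_div_cancel₀ _ hZ1.ne']
      -- the two sides, split at the first layer
      have hL : ∑ x, gibbsLaw (S 0) x * sqBack (n + 1) S (fun k _ y => gibbsLaw (S k.succ) y) x =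
          (partitionFn (S 0))⁻¹ * ((∑ x, m x * u x) * ∑ z, gibbsLaw (S 1) z * Bp z) := by
        simp only [gibbsLaw_mul_sqBack_succ, ← mul_sum]
        congr 1
        rw [sum_mul]
        refine sum_congr rfl fun x _ => ?_
        simp only [hm, hu, hBp, hS', Fin.succ_zero_eq_one]
        ring
      have hR : ∑ x, gibbsLaw (S 0) x * sqBack (n + 1) S P x =
          (partitionFn (S 0))⁻¹ * ∑ x, m x * (u x * g x) := by
        simp only [gibbsLaw_mul_sqBack_succ, ← mul_sum]
        rfl
      rw [hL, hR]
      refine mul_le_mul_of_nonneg_left ?_ (inv_nonneg.mpr hZ0.le)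
      -- `(Σ m u) · Σ p₁ Bp ≤ (Σ m u) · Σ p₁ B ≤ Σ m u g`
      have hmu0 : 0 ≤ ∑ x, m x * u x := sum_nonneg fun x _ => mul_nonneg (hm0 x) (Real.exp_pos _).le
      have step1 : (∑ x, m x * u x) * ∑ z, gibbsLaw (S 1) z * Bp z ≤
          (∑ x, m x * u x) * ∑ z, gibbsLaw (S 1) z * B z := mul_le_mul_of_nonneg_left ih hmu0
      have step2 : partitionFn (S 1) * ((∑ x, m x * u x) * ∑ z, gibbsLaw (S 1) z * B z) ≤
          partitionFn (S 1) * ∑ x, m x * (u x * g x) := by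
        calc partitionFn (S 1) * ((∑ x, m x * u x) * ∑ z, gibbsLaw (S 1) z * B z)
            = (∑ x, m x * u x) * (∑ x, m x * g x) := by rw [hmg]; ring
          _ ≤ (∑ x, m x) * ∑ x, m x * (u x * g x) := hcheb
          _ = partitionFn (S 1) * ∑ x, m x * (u x * g x) := by rw [hZ1eq]
      exact step1.trans (le_of_mul_le_mul_left step2 hZ1)

/-! ## (C3″) -/

/-- **(C3″) PERFECT RELAXATION DOMINATES MONOTONE LAYERS (proved; repairs the refuted (C3′)).**
For a protocol `S 0, …, S n` on a finite space whose increments `S_{k+1} − S_k` are non-decreasing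
functions of an order parameter `A`, and MC layers `P_k` that are positive, leave `e^{−S_{k+1}}`
stationary and map `A`-antitone functions to `A`-antitone functions (stochastic monotonicity),
the NE-MCMC / SNF reweighting ESS is at most its perfect-relaxation value:
`essFrac (revPathLaw S P) (pathLaw p₀ P) ≤ Π_k ESS(p_{k+1}, p_k)`.  No reversibility and no
positive-semidefiniteness is assumed. [folklore] -/
theorem perfectRelaxation_dominates_monotone [Nonempty X] [DecidableEq X] {n : ℕ} (A : X → ℝ)
    (S : Fin (n + 1) → X → ℝ) (P : Fin n → X → X → ℝ)
    (hinc : ∀ (k : Fin n) (x y : X), A x ≤ A y →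
      S k.succ x - S k.castSucc x ≤ S k.succ y - S k.castSucc y)
    (hPpos : ∀ k x y, 0 < P k x y)
    (hst : ∀ k : Fin n, IsStationary (fun x => Real.exp (-(S k.succ x))) (P k))
    (hmono : ∀ (k : Fin n) (f : X → ℝ), (∀ x y, A x ≤ A y → f y ≤ f x) →
      ∀ x y, A x ≤ A y → ∑ z, P k y z * f z ≤ ∑ z, P k x z * f z) :
    essFrac (revPathLaw S P) (pathLaw (gibbsLaw (S 0)) P) ≤
      ∏ k : Fin n, essFrac (gibbsLaw (S k.succ)) (gibbsLaw (S k.castSucc)) := by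
  have hPerf : ∀ (k : Fin n) (x y : X), 0 < (fun (k : Fin n) (_ : X) (y : X) =>
      gibbsLaw (S k.succ) y) k x y := fun k _ y => gibbsLaw_pos (S k.succ) y
  have hM : ∑ ω : Fin (n + 1) → X, pathLaw (gibbsLaw (S 0)) (fun k _ y => gibbsLaw (S k.succ) y) ω *
        Real.exp (-(work S ω)) ^ 2 ≤
      ∑ ω : Fin (n + 1) → X, pathLaw (gibbsLaw (S 0)) P ω * Real.exp (-(work S ω)) ^ 2 := by
    rw [sum_pathLaw_mul_exp_sq, sum_pathLaw_mul_exp_sq]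
    exact sqMoment_perfect_le A n S P hinc (fun k x y => (hPpos k x y).le) hst hmono
  have hpos : 0 < ∑ ω : Fin (n + 1) → X, pathLaw (gibbsLaw (S 0))
      (fun k _ y => gibbsLaw (S k.succ) y) ω * Real.exp (-(work S ω)) ^ 2 :=
    sum_pos (fun ω _ => mul_pos (pathLaw_pos (gibbsLaw_pos (S 0)) hPerf ω)
      (pow_pos (Real.exp_pos _) 2)) univ_nonempty
  rw [← ess_perfect_relaxation S, essFrac_path_eq S hPpos, essFrac_path_eq S hPerf,
    jarzynski S P hst, jarzynski S _ (isStationary_perfect S)]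
  exact div_le_div_of_nonneg_left (sq_nonneg _) hpos hM

/-- **(C3″), exponential-family form** — the binder format of the refuted (C3′)
`Conjectures.PerfectRelaxationDominates` with positive-semidefiniteness REPLACED by stochastic
monotonicity of the layers in `A` (and the layers positive): `S_k = β_k · A`, `β` monotone,
row-stochastic positive layers in detailed balance with `e^{−β_{k+1} A}` that map `A`-antitone
functions to `A`-antitone functions ⟹ `ÊSS ≤ Π_k ESS(p_{k+1}, p_k)`. [folklore] -/
theorem perfectRelaxation_dominates_expFamily (Y : Type) [Fintype Y] [DecidableEq Y] [Nonempty Y]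
    (n : ℕ) (A : Y → ℝ) (β : Fin (n + 1) → ℝ) (P : Fin n → Y → Y → ℝ) (hβ : Monotone β)
    (hrow : ∀ k, IsRowStochastic (P k)) (hPpos : ∀ k x y, 0 < P k x y)
    (hdb : ∀ k : Fin n, DetailedBalance (fun x => Real.exp (-(β k.succ * A x))) (P k))
    (hmono : ∀ (k : Fin n) (f : Y → ℝ), (∀ x y, A x ≤ A y → f y ≤ f x) →
      ∀ x y, A x ≤ A y → ∑ z, P k y z * f z ≤ ∑ z, P k x z * f z) :
    essFrac (revPathLaw (fun k x => β k * A x) P)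
        (pathLaw (gibbsLaw (fun x => β 0 * A x)) P) ≤
      ∏ k : Fin n, essFrac (gibbsLaw (fun x => β k.succ * A x))
        (gibbsLaw (fun x => β k.castSucc * A x)) :=
  perfectRelaxation_dominates_monotone A (fun k x => β k * A x) P
    (fun k x y hxy => by
      have hk : β k.castSucc ≤ β k.succ := hβ Fin.castSucc_lt_succ.le
      nlinarith)
    hPpos (fun k => (hdb k).isStationary (hrow k).2) hmono

end Summit.Ventures.LatticeQCDFlow.Theory2

end
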